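import Literature.Combinatorics.SimpleGraph.HamiltonianGadgetForcing
import Mathlib.Data.Fintype.Sum
import Mathlib.Data.Fintype.Prod
import Mathlib.Algebra.Group.Nat.Even
import Mathlib.Data.List.GetD
import HarnessLib

/-!
# Gadget substitution for Hamiltonian-path counts, VI: rail gadgets (generic theory)

A **rail gadget** has `k` rails of `K` nodes (`K` even), rail `r` running
`port r true – node (r,0) – … – node (r,K-1) – port r false` with the slot `(port r true, port r false)`,
and a perfect matching of **rungs** on the `k·K` rail nodes, every rung subdivided by a midpoint of degree
two. The subdivided ladder of `HamiltonianGadgetLadder.lean` (2 rails, `K = 4`, rungs `(L,i)–(R,i)`) and the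
planar OR-gadgets found by search (3 rails, `K = 6`) are instances.

The point of the notion: for any family of port-to-port strands covering such a gadget
(`StrandFamily`, the hypothesis of exclusivity and the shape of every cover) the whole **link relation is
determined by which rails are entered** (`RailGadget.link_iff_linkB`): every midpoint forces its rung; along
a rail the rail edges then alternate (`RailGadget.rail_step`), starting with "unused" at an entered rail
(`open`) and with "used" otherwise, and an entered rail is left through its other port
(`RailGadget.link_port_false_iff`). Consequently the strands are the walks of an explicit finite relation
`RailGadget.linkB Γ U`, and the census and the exclusivity of a concrete rail gadget reduce to decidable
checks on these walks (`RailGadget.eq_walk_of_forcedB`, and the packaging theorems below), discharged by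
`decide` for each template.

## References

* M. R. Garey, D. S. Johnson, R. E. Tarjan, SIAM J. Comput. 5 (1976) 704–714, §2 (degree-two forcing).
* M. Liśkiewicz, M. Ogihara, S. Toda, TCS 304 (2003) 129–156, §3 (XOR-gadget as a ladder).
-/

namespace Literature.Combinatorics.SimpleGraph

/-! ### Vertices -/

/-- The vertices of a rail gadget with `k` rails of `K` nodes and `m` rungs: rail nodes, rung midpoints,
ports. [folklore] -/
inductive RailV (k K m : ℕ)
  | node (x : Fin k × Fin K)
  | mid (ρ : Fin m)
  | port (r : Fin k) (top : Bool)
  deriving DecidableEq, Repr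

namespace RailV

variable {k K m : ℕ}

/-- Vertices as a sum type (for finiteness). [folklore] -/
def toSum : RailV k K m → (Fin k × Fin K) ⊕ Fin m ⊕ (Fin k × Bool)
  | node x => Sum.inl x
  | mid ρ => Sum.inr (Sum.inl ρ)
  | port r t => Sum.inr (Sum.inr (r, t))

/-- Inverse of `toSum`. [folklore] -/
def ofSum : (Fin k × Fin K) ⊕ Fin m ⊕ (Fin k × Bool) → RailV k K m
  | Sum.inl x => node x
  | Sum.inr (Sum.inl ρ) => mid ρ
  | Sum.inr (Sum.inr p) => port p.1 p.2

/-- `RailV` is equivalent to a sum of finite types. [folklore] -/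
def equivSum : RailV k K m ≃ (Fin k × Fin K) ⊕ Fin m ⊕ (Fin k × Bool) where
  toFun := toSum
  invFun := ofSum
  left_inv x := by cases x <;> rfl
  right_inv x := by rcases x with x | ρ | p <;> rfl

/-- The vertices form a finite type. [folklore] -/
instance : Fintype (RailV k K m) :=
  Fintype.ofEquiv _ equivSum.symm

/-- Inner vertices (rail nodes and midpoints), as opposed to ports. [folklore] -/
def isInner : RailV k K m → Bool
  | port _ _ => false
  | _ => true

end RailV

open RailV

/-! ### Rail gadgets -/

/-- **A rail gadget**: the rung matching on the rail nodes, given by the two ends `fst ρ ≠ snd ρ` of each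
rung `ρ` and the rung `rungOf x` through each node `x`; `K ≥ 2` even. [folklore] -/
structure RailGadget (k K m : ℕ) where
  /-- first end of a rung -/
  fst : Fin m → Fin k × Fin K
  /-- second end of a rung -/
  snd : Fin m → Fin k × Fin K
  /-- the rung through a node -/
  rungOf : Fin k × Fin K → Fin m
  fst_ne_snd : ∀ ρ, fst ρ ≠ snd ρ
  rungOf_spec : ∀ x, fst (rungOf x) = x ∨ snd (rungOf x) = x
  rungOf_fst : ∀ ρ, rungOf (fst ρ) = ρ
  rungOf_snd : ∀ ρ, rungOf (snd ρ) = ρ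
  two_le : 2 ≤ K
  even : Even K

namespace RailGadget

variable {k K m : ℕ} (Γ : RailGadget k K m)

/-- The edges, as a Boolean relation (symmetrised below): consecutive rail nodes, rung halves, port
edges. [folklore] -/
def relB : RailV k K m → RailV k K m → Bool
  | .node x, .node y => x.1 == y.1 && (x.2.val + 1 == y.2.val)
  | .mid ρ, .node x => Γ.fst ρ == x || Γ.snd ρ == x
  | .port r true, .node x => x.1 == r && (x.2.val == 0)
  | .port r false, .node x => x.1 == r && (x.2.val + 1 == K)
  | _, _ => false

/-- **The graph of the rail gadget.** [folklore] -/
def graph : _root_.SimpleGraph (RailV k K m) :=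
  _root_.SimpleGraph.fromRel fun a b => Γ.relB a b = true

/-- Adjacency in the gadget graph is decidable. [folklore] -/
instance : DecidableRel Γ.graph.Adj := fun a b =>
  inferInstanceAs (Decidable (a ≠ b ∧ (Γ.relB a b = true ∨ Γ.relB b a = true)))

/-- The gadget vertices: all inner vertices. [folklore] -/
def VX (_Γ : RailGadget k K m) : Finset (RailV k K m) :=
  Finset.univ.filter fun v => isInner v = true

/-- The slot of rail `r`. [folklore] -/
def slot (_Γ : RailGadget k K m) (r : Fin k) : RailV k K m × RailV k K m :=
  (port r true, port r false)

/-- A rail has at least one node. [folklore] -/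
theorem pos (Γ : RailGadget k K m) : 0 < K := by
  have := Γ.two_le; omega

/-- A rail has at least two nodes. [folklore] -/
theorem one_lt (Γ : RailGadget k K m) : 1 < K := by
  have := Γ.two_le; omega

/-- Membership in the gadget vertex set. [folklore] -/
theorem mem_VX_iff {v : RailV k K m} : v ∈ Γ.VX ↔ isInner v = true := by
  simp [VX]

/-- Rail nodes are gadget vertices. [folklore] -/
theorem node_mem (x : Fin k × Fin K) : node x ∈ Γ.VX := Γ.mem_VX_iff.2 rfl

/-- Rung midpoints are gadget vertices. [folklore] -/
theorem mid_mem (ρ : Fin m) : mid ρ ∈ Γ.VX := Γ.mem_VX_iff.2 rfl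

/-- Ports are not gadget vertices. [folklore] -/
theorem port_not_mem (r : Fin k) (t : Bool) : port r t ∉ Γ.VX := by
  simp [mem_VX_iff, isInner]

/-- The rung at a node is unique. [folklore] -/
theorem eq_rungOf_of_fst {ρ : Fin m} {x : Fin k × Fin K} (h : Γ.fst ρ = x) : ρ = Γ.rungOf x := by
  rw [← h, Γ.rungOf_fst]

/-- The rung at a node is unique (second end). [folklore] -/
theorem eq_rungOf_of_snd {ρ : Fin m} {x : Fin k × Fin K} (h : Γ.snd ρ = x) : ρ = Γ.rungOf x := by
  rw [← h, Γ.rungOf_snd]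

/-! ### Adjacency -/

/-- Adjacency in the gadget graph, unfolded. [folklore] -/
theorem adj_iff {a b : RailV k K m} : Γ.graph.Adj a b ↔ a ≠ b ∧ (Γ.relB a b = true ∨ Γ.relB b a = true) :=
  _root_.SimpleGraph.fromRel_adj _ _ _

/-- The neighbours of a midpoint: the two ends of its rung. [folklore] -/
theorem adj_mid_iff {ρ : Fin m} {y : RailV k K m} :
    Γ.graph.Adj (mid ρ) y ↔ y = node (Γ.fst ρ) ∨ y = node (Γ.snd ρ) := by
  rw [adj_iff]
  cases y with
  | node x =>
    simp only [ne_eq, reduceCtorEq, not_false_eq_true, relB, Bool.or_eq_true, beq_iff_eq, Bool.false_eq_true,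
      or_false, true_and, node.injEq]
    constructor <;> rintro (h | h) <;> simp [h]
  | mid ρ' => simp [relB]
  | port r t => cases t <;> simp [relB]

/-- The neighbour of a top port: the first node of its rail. [folklore] -/
theorem adj_port_true_iff {r : Fin k} {y : RailV k K m} :
    Γ.graph.Adj (port r true) y ↔ ∃ x, y = node x ∧ x.1 = r ∧ x.2.val = 0 := by
  rw [adj_iff]
  cases y with
  | node x => simp [relB]
  | mid ρ' => simp [relB]
  | port r t => cases t <;> simp [relB]

/-- The neighbour of a bottom port: the last node of its rail. [folklore] -/
theorem adj_port_false_iff {r : Fin k} {y : RailV k K m} :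
    Γ.graph.Adj (port r false) y ↔ ∃ x, y = node x ∧ x.1 = r ∧ x.2.val + 1 = K := by
  rw [adj_iff]
  cases y with
  | node x => simp [relB]
  | mid ρ' => simp [relB]
  | port r t => cases t <;> simp [relB]

/-- The neighbours of a rail node: its rung midpoint, the adjacent rail nodes, its port if it is an end
node. [folklore] -/
theorem adj_node_iff {x : Fin k × Fin K} {y : RailV k K m} :
    Γ.graph.Adj (node x) y ↔
      y = mid (Γ.rungOf x) ∨
      (∃ x', y = node x' ∧ x'.1 = x.1 ∧ (x.2.val + 1 = x'.2.val ∨ x'.2.val + 1 = x.2.val)) ∨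
      (y = port x.1 true ∧ x.2.val = 0) ∨ (y = port x.1 false ∧ x.2.val + 1 = K) := by
  rw [adj_iff]
  cases y with
  | node x' =>
    simp only [ne_eq, node.injEq, relB, Bool.and_eq_true, beq_iff_eq, reduceCtorEq, false_and, or_false,
      exists_eq_left', false_or]
    constructor
    · rintro ⟨hne, ⟨h1, h2⟩ | ⟨h1, h2⟩⟩
      · exact ⟨h1.symm, Or.inl h2⟩
      · exact ⟨h1, Or.inr h2⟩
    · rintro ⟨h1, h2 | h2⟩
      · refine ⟨?_, Or.inl ⟨h1.symm, h2⟩⟩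
        rintro rfl; omega
      · refine ⟨?_, Or.inr ⟨h1, h2⟩⟩
        rintro rfl; omega
  | mid ρ =>
    simp only [ne_eq, reduceCtorEq, not_false_eq_true, relB, Bool.false_eq_true, Bool.or_eq_true, beq_iff_eq,
      false_or, true_and, mid.injEq, false_and, exists_false, or_false]
    constructor
    · rintro (h | h)
      · exact Γ.eq_rungOf_of_fst h
      · exact Γ.eq_rungOf_of_snd h
    · rintro rfl
      exact Γ.rungOf_spec x
  | port r t =>
    cases t
    · simp only [ne_eq, reduceCtorEq, not_false_eq_true, relB, Bool.false_eq_true, Bool.and_eq_true, beq_iff_eq,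
        false_or, true_and, false_and, exists_false, port.injEq, Bool.false_eq_true, and_false, and_true]
      constructor
      · rintro ⟨h1, h2⟩; exact ⟨h1.symm, h2⟩
      · rintro ⟨h1, h2⟩; exact ⟨h1.symm, h2⟩
    · simp only [ne_eq, reduceCtorEq, not_false_eq_true, relB, Bool.false_eq_true, Bool.and_eq_true, beq_iff_eq,
        false_or, true_and, false_and, exists_false, port.injEq, and_true, Bool.true_eq_false, and_false, or_false]
      constructor
      · rintro ⟨h1, h2⟩; exact ⟨h1.symm, h2⟩
      · rintro ⟨h1, h2⟩; exact ⟨h1.symm, h2⟩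

/-- The node of rail `r` at position `i`. [folklore] -/
def nodeAt (r : Fin k) (i : ℕ) (h : i < K) : RailV k K m :=
  node (r, ⟨i, h⟩)

/-- Nodes given by equal positions are equal. [folklore] -/
theorem nodeAt_congr {r : Fin k} {i j : ℕ} (hi : i < K) (hj : j < K) (h : i = j) :
    (nodeAt r i hi : RailV k K m) = nodeAt r j hj := by
  subst h; rfl

/-- A node written by its position. [folklore] -/
theorem node_eq_nodeAt (x : Fin k × Fin K) : (node x : RailV k K m) = nodeAt x.1 x.2.val x.2.isLt := by
  rfl

/-- The neighbours of an interior rail node. [folklore] -/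
theorem adj_nodeAt_interior {r : Fin k} {i : ℕ} (h0 : 0 < i) (hi : i + 1 < K) {y : RailV k K m}
    (hy : Γ.graph.Adj (nodeAt r i (by omega)) y) :
    y = mid (Γ.rungOf (r, ⟨i, by omega⟩)) ∨ y = nodeAt r (i - 1) (by omega) ∨ y = nodeAt r (i + 1) hi := by
  rcases (Γ.adj_node_iff).1 hy with h | ⟨x', rfl, h1, h2⟩ | ⟨-, h⟩ | ⟨-, h⟩
  · exact Or.inl h
  · simp only at h1 h2
    rcases h2 with h2 | h2
    · right; right
      obtain ⟨r', j⟩ := x'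
      simp only at h1 h2
      subst h1
      exact congrArg node (Prod.ext rfl (Fin.ext (by simp; omega)))
    · right; left
      obtain ⟨r', j⟩ := x'
      simp only at h1 h2
      subst h1
      exact congrArg node (Prod.ext rfl (Fin.ext (by simp; omega)))
  · simp at h; omega
  · simp at h; omega

/-- The neighbours of the first rail node. [folklore] -/
theorem adj_nodeAt_first {r : Fin k} (hK : 1 < K) {y : RailV k K m} (hy : Γ.graph.Adj (nodeAt r 0 (by omega)) y) :
    y = mid (Γ.rungOf (r, ⟨0, by omega⟩)) ∨ y = nodeAt r 1 hK ∨ y = port r true := by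
  rcases (Γ.adj_node_iff).1 hy with h | ⟨x', rfl, h1, h2⟩ | ⟨h, -⟩ | ⟨-, h⟩
  · exact Or.inl h
  · simp only at h1 h2
    rcases h2 with h2 | h2
    · right; left
      obtain ⟨r', j⟩ := x'
      simp only at h1 h2
      subst h1
      exact congrArg node (Prod.ext rfl (Fin.ext (by simp; omega)))
    · omega
  · exact Or.inr (Or.inr h)
  · simp at h; omega

/-- The neighbours of the last rail node. [folklore] -/
theorem adj_nodeAt_last {r : Fin k} (hK : 1 < K) {y : RailV k K m}
    (hy : Γ.graph.Adj (nodeAt r (K - 1) (by omega)) y) :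
    y = mid (Γ.rungOf (r, ⟨K - 1, by omega⟩)) ∨ y = nodeAt r (K - 2) (by omega) ∨ y = port r false := by
  rcases (Γ.adj_node_iff).1 hy with h | ⟨x', rfl, h1, h2⟩ | ⟨-, h⟩ | ⟨h, -⟩
  · exact Or.inl h
  · simp only at h1 h2
    rcases h2 with h2 | h2
    · have := x'.2.isLt; omega
    · right; left
      obtain ⟨r', j⟩ := x'
      simp only at h1 h2
      subst h1
      exact congrArg node (Prod.ext rfl (Fin.ext (by simp; omega)))
  · simp at h; omega
  · exact Or.inr (Or.inr h)

/-! ### The link relation of a strand family is determined by the entered rails -/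

section family

variable {P : Finset (RailV k K m)} {T : Set (RailV k K m × List (RailV k K m) × RailV k K m)}
  (hT : StrandFamily Γ.graph Γ.VX P T)
include hT

/-- Every rung is forced: its midpoint is linked to both its ends and to nothing else. [folklore] -/
theorem link_mid (ρ : Fin m) :
    Link T (mid ρ) (node (Γ.fst ρ)) ∧ Link T (mid ρ) (node (Γ.snd ρ)) ∧
      ∀ y, Link T (mid ρ) y → y = node (Γ.fst ρ) ∨ y = node (Γ.snd ρ) :=
  hT.links_of_adj_two (Γ.mid_mem ρ) fun _ hy => (Γ.adj_mid_iff).1 hy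

/-- Every rail node is linked to the midpoint of its rung. [folklore] -/
theorem link_node_mid (x : Fin k × Fin K) : Link T (node x) (mid (Γ.rungOf x)) := by
  rcases Γ.rungOf_spec x with h | h
  · have := (Γ.link_mid hT (Γ.rungOf x)).1
    rw [h] at this
    exact link_comm.1 this
  · have := (Γ.link_mid hT (Γ.rungOf x)).2.1
    rw [h] at this
    exact link_comm.1 this

/-- Rail `r` is **entered** (open): its top port is linked to its first node. [folklore] -/
def IsOpen (T : Set (RailV k K m × List (RailV k K m) × RailV k K m)) (hK : 0 < K) (r : Fin k) : Prop :=
  Link T (port r true) (nodeAt r 0 hK)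

omit hT in
/-- A link at a top port is the link to the first node. [folklore] -/
theorem isOpen_of_link_port_true (hT : StrandFamily Γ.graph Γ.VX P T) {r : Fin k} {y : RailV k K m}
    (h : Link T (port r true) y) : IsOpen T (Γ.pos) r := by
  obtain ⟨x, rfl, h1, h2⟩ := (Γ.adj_port_true_iff).1 (hT.adj_of_link h)
  have : (node x : RailV k K m) = nodeAt r 0 (Γ.pos) := by
    obtain ⟨r', j⟩ := x
    simp only at h1 h2
    subst h1
    exact congrArg node (Prod.ext rfl (Fin.ext h2))
  rwa [this] at h

/-- The rail edge between positions `i` and `i + 1` of a rail: used iff `i` is odd on an entered rail,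
iff `i` is even otherwise. [folklore] -/
def usedE (isOpen : Bool) (i : ℕ) : Bool :=
  if isOpen then i % 2 == 1 else i % 2 == 0

omit hT in
/-- The alternation rule flips from one rail edge to the next. [folklore] -/
theorem usedE_succ_iff (b : Bool) (i : ℕ) : usedE b (i + 1) = true ↔ usedE b i = false := by
  unfold usedE
  cases b <;> simp <;> omega

/-- **Alternation along a rail**: the rail edge `i – i+1` is used iff `usedE b i`, `b` recording whether
the rail is entered. [folklore] -/
theorem rail_step (r : Fin k) (b : Bool) (hb : b = true ↔ IsOpen T Γ.pos r) :
    ∀ i (hi : i + 1 < K), Link T (nodeAt r i (by omega)) (nodeAt r (i + 1) hi) ↔ usedE b i = true := by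
  have hK := Γ.two_le
  intro i
  induction i with
  | zero =>
    intro hi
    -- at the first node: the mid, node 1 and the top port
    have h := hT.link_iff_not_link_of_adj_three (x := nodeAt r 0 (by omega))
      (n₁ := mid (Γ.rungOf (r, ⟨0, by omega⟩))) (n₂ := nodeAt r 1 hi) (n₃ := port r true)
      (Γ.node_mem _) (fun y hy => Γ.adj_nodeAt_first hi hy) (by simp [nodeAt]) (by simp)
      (by simp [nodeAt]) (Γ.link_node_mid hT _)
    rw [h, link_comm]
    unfold usedE IsOpen at *
    cases b
    · simp only [Bool.false_eq_true, false_iff] at hb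
      simp [hb]
    · simp only [true_iff] at hb
      simp [hb]
  | succ i ih =>
    intro hi
    have h := hT.link_iff_not_link_of_adj_three (x := nodeAt r (i + 1) (by omega))
      (n₁ := mid (Γ.rungOf (r, ⟨i + 1, by omega⟩))) (n₂ := nodeAt r i (by omega)) (n₃ := nodeAt r (i + 2) hi)
      (Γ.node_mem _) (fun y hy => ?_) (by simp [nodeAt]) (by simp [nodeAt]) (by simp [nodeAt, Fin.ext_iff])
      (Γ.link_node_mid hT _)
    · rw [link_comm, ih (by omega)] at h
      -- `h : usedE b i ↔ ¬ Link (node (i+1)) (node (i+2))`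
      rw [usedE_succ_iff]
      cases hu : usedE b i
      · rw [hu] at h; simp at h ⊢; exact h
      · rw [hu] at h; simp at h ⊢; exact h
    · rcases Γ.adj_nodeAt_interior (i := i + 1) (by omega) hi hy with h | h | h
      · exact Or.inl h
      · exact Or.inr (Or.inl (by simpa using h))
      · exact Or.inr (Or.inr h)

/-- **An entered rail is left through its bottom port**, and only an entered rail. [folklore] -/
theorem link_port_false_iff (r : Fin k) :
    Link T (nodeAt r (K - 1) (by have := Γ.two_le; omega)) (port r false) ↔ IsOpen T Γ.pos r := by
  have hK := Γ.two_le
  obtain ⟨j, hj⟩ := Γ.even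
  have h := hT.link_iff_not_link_of_adj_three (x := nodeAt r (K - 1) (by omega))
    (n₁ := mid (Γ.rungOf (r, ⟨K - 1, by omega⟩))) (n₂ := nodeAt r (K - 2) (by omega)) (n₃ := port r false)
    (Γ.node_mem _) (fun y hy => Γ.adj_nodeAt_last (by omega) hy) (by simp [nodeAt]) (by simp)
    (by simp [nodeAt]) (Γ.link_node_mid hT _)
  by_cases ho : IsOpen T Γ.pos r
  · -- the rail edge `K-2 – K-1` is unused
    have hstep := Γ.rail_step hT r true (by simp [ho]) (K - 2) (by omega)
    have heq : (nodeAt r (K - 2 + 1) (by omega) : RailV k K m) = nodeAt r (K - 1) (by omega) :=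
      nodeAt_congr _ _ (by omega)
    rw [heq, link_comm] at hstep
    rw [hstep] at h
    have hpar : usedE true (K - 2) = false := by unfold usedE; simp; omega
    rw [hpar] at h
    simp only [Bool.false_eq_true, false_iff, not_not] at h
    exact iff_of_true h ho
  · have hstep := Γ.rail_step hT r false (by simp [ho]) (K - 2) (by omega)
    have heq : (nodeAt r (K - 2 + 1) (by omega) : RailV k K m) = nodeAt r (K - 1) (by omega) :=
      nodeAt_congr _ _ (by omega)
    rw [heq, link_comm] at hstep
    rw [hstep] at h
    have hpar : usedE false (K - 2) = true := by unfold usedE; simp; omega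
    rw [hpar] at h
    simp only [true_iff] at h
    exact iff_of_false h ho

omit hT in
/-- A node written by rail and position. [folklore] -/
theorem node_eq_nodeAt_of {x : Fin k × Fin K} {r : Fin k} {i : ℕ} (h1 : x.1 = r) (h2 : x.2.val = i)
    (hi : i < K) : (node x : RailV k K m) = nodeAt r i hi := by
  obtain ⟨r', j⟩ := x
  simp only at h1 h2
  subst h1; subst h2
  rfl

/-- **Links between rail nodes**: consecutive nodes of one rail, the rail edge being used according to
the alternation rule. [folklore] -/
theorem link_node_node_iff (U : Fin k → Bool) (hU : ∀ r, U r = true ↔ IsOpen T Γ.pos r) (x y : Fin k × Fin K) :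
    Link T (node x) (node y) ↔ x.1 = y.1 ∧
      ((x.2.val + 1 = y.2.val ∧ usedE (U x.1) x.2.val = true) ∨ (y.2.val + 1 = x.2.val ∧ usedE (U x.1) y.2.val = true)) := by
  have step : ∀ (a b : Fin k × Fin K), a.1 = b.1 → a.2.val + 1 = b.2.val →
      (Link T (node a) (node b) ↔ usedE (U a.1) a.2.val = true) := by
    intro a b h1 h2
    have hs := Γ.rail_step hT a.1 (U a.1) (hU a.1) a.2.val (by have := b.2.isLt; omega)
    rw [node_eq_nodeAt_of (x := a) rfl rfl a.2.isLt, node_eq_nodeAt_of (x := b) h1.symm h2.symm (by omega)]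
    exact hs
  constructor
  · intro h
    have hadj := hT.adj_of_link h
    rcases (Γ.adj_node_iff).1 hadj with h' | ⟨x', hx', h1, h2⟩ | ⟨h', -⟩ | ⟨h', -⟩
    · simp at h'
    · have hy : x' = y := (node.inj hx').symm
      subst hy
      refine ⟨h1.symm, ?_⟩
      rcases h2 with h2 | h2
      · exact Or.inl ⟨h2, (step x x' h1.symm h2).1 h⟩
      · refine Or.inr ⟨h2, ?_⟩
        have := (step x' x h1 h2).1 (link_comm.1 h)
        rwa [h1] at this
    · simp at h'
    · simp at h'
  · rintro ⟨h1, ⟨h2, hu⟩ | ⟨h2, hu⟩⟩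
    · exact (step x y h1 h2).2 hu
    · have := (step y x h1.symm h2).2 (by rwa [← h1])
      exact link_comm.1 this

/-- **Links at a midpoint**: exactly the two rung halves. [folklore] -/
theorem link_mid_node_iff (ρ : Fin m) (x : Fin k × Fin K) :
    Link T (mid ρ) (node x) ↔ Γ.fst ρ = x ∨ Γ.snd ρ = x := by
  obtain ⟨h1, h2, honly⟩ := Γ.link_mid hT ρ
  constructor
  · intro h
    rcases honly _ h with h' | h' <;> simp only [node.injEq] at h'
    · exact Or.inl h'.symm
    · exact Or.inr h'.symm
  · rintro (rfl | rfl)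
    · exact h1
    · exact h2

/-- **Links at a top port**: to the first node, iff the rail is entered. [folklore] -/
theorem link_port_true_node_iff (U : Fin k → Bool) (hU : ∀ r, U r = true ↔ IsOpen T Γ.pos r) (r : Fin k)
    (x : Fin k × Fin K) : Link T (port r true) (node x) ↔ U r = true ∧ x.1 = r ∧ x.2.val = 0 := by
  constructor
  · intro h
    obtain ⟨x', hx', h1, h2⟩ := (Γ.adj_port_true_iff).1 (hT.adj_of_link h)
    have hx : x' = x := (node.inj hx').symm
    subst hx
    refine ⟨(hU r).2 ?_, h1, h2⟩
    unfold IsOpen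
    rwa [node_eq_nodeAt_of h1 h2 Γ.pos] at h
  · rintro ⟨hu, h1, h2⟩
    have := (hU r).1 hu
    unfold IsOpen at this
    rwa [node_eq_nodeAt_of h1 h2 Γ.pos]

/-- **Links at a bottom port**: to the last node, iff the rail is entered. [folklore] -/
theorem link_port_false_node_iff (U : Fin k → Bool) (hU : ∀ r, U r = true ↔ IsOpen T Γ.pos r) (r : Fin k)
    (x : Fin k × Fin K) : Link T (port r false) (node x) ↔ U r = true ∧ x.1 = r ∧ x.2.val + 1 = K := by
  have hK := Γ.two_le
  constructor
  · intro h
    obtain ⟨x', hx', h1, h2⟩ := (Γ.adj_port_false_iff).1 (hT.adj_of_link h)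
    have hx : x' = x := (node.inj hx').symm
    subst hx
    refine ⟨(hU r).2 ?_, h1, h2⟩
    rw [← Γ.link_port_false_iff hT r, link_comm]
    rwa [node_eq_nodeAt_of h1 (i := K - 1) (by omega) (by omega)] at h
  · rintro ⟨hu, h1, h2⟩
    have := (Γ.link_port_false_iff hT r).2 ((hU r).1 hu)
    rw [link_comm] at this
    rwa [node_eq_nodeAt_of h1 (i := K - 1) (by omega) (by omega)]

/-- No links avoid the rail nodes. [folklore] -/
theorem not_link_of_not_node {v w : RailV k K m} (hv : ∀ x, v ≠ node x) (hw : ∀ x, w ≠ node x) :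
    ¬ Link T v w := by
  intro h
  have hadj := hT.adj_of_link h
  cases v with
  | node x => exact hv x rfl
  | mid ρ =>
    rcases (Γ.adj_mid_iff).1 hadj with h' | h'
    · exact hw _ h'
    · exact hw _ h'
  | port r t =>
    cases t
    · obtain ⟨x, hx, -⟩ := (Γ.adj_port_false_iff).1 hadj
      exact hw _ hx
    · obtain ⟨x, hx, -⟩ := (Γ.adj_port_true_iff).1 hadj
      exact hw _ hx

/-- **The explicit link relation** of a rail gadget whose entered rails are `U`. [folklore] -/
def linkB (U : Fin k → Bool) : RailV k K m → RailV k K m → Bool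
  | .mid ρ, .node x => Γ.fst ρ == x || Γ.snd ρ == x
  | .node x, .mid ρ => Γ.fst ρ == x || Γ.snd ρ == x
  | .node x, .node y => x.1 == y.1 &&
      ((x.2.val + 1 == y.2.val && usedE (U x.1) x.2.val) || (y.2.val + 1 == x.2.val && usedE (U x.1) y.2.val))
  | .port r true, .node x => U r && (x.1 == r && x.2.val == 0)
  | .node x, .port r true => U r && (x.1 == r && x.2.val == 0)
  | .port r false, .node x => U r && (x.1 == r && x.2.val + 1 == K)
  | .node x, .port r false => U r && (x.1 == r && x.2.val + 1 == K)
  | _, _ => false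

/-- **The links of a strand family of a rail gadget are determined by the entered rails.**
[folklore] -/
theorem link_iff_linkB (U : Fin k → Bool) (hU : ∀ r, U r = true ↔ IsOpen T Γ.pos r) (v w : RailV k K m) :
    Link T v w ↔ Γ.linkB U v w = true := by
  cases v with
  | node x =>
    cases w with
    | node y =>
      rw [Γ.link_node_node_iff hT U hU]
      simp [linkB]
    | mid ρ =>
      rw [link_comm, Γ.link_mid_node_iff hT]
      simp [linkB]
    | port r t =>
      cases t
      · rw [link_comm, Γ.link_port_false_node_iff hT U hU]
        simp [linkB]
      · rw [link_comm, Γ.link_port_true_node_iff hT U hU]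
        simp [linkB]
  | mid ρ =>
    cases w with
    | node y =>
      rw [Γ.link_mid_node_iff hT]
      simp [linkB]
    | mid ρ' =>
      simp only [linkB, Bool.false_eq_true, iff_false]
      exact Γ.not_link_of_not_node hT (by simp) (by simp)
    | port r t =>
      have : ¬ Link T (mid ρ) (port r t) := Γ.not_link_of_not_node hT (by simp) (by simp)
      cases t <;> simp [linkB, this]
  | port r t =>
    cases w with
    | node y =>
      cases t
      · rw [Γ.link_port_false_node_iff hT U hU]
        simp [linkB]
      · rw [Γ.link_port_true_node_iff hT U hU]
        simp [linkB]
    | mid ρ' =>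
      have : ¬ Link T (port r t) (mid ρ') := Γ.not_link_of_not_node hT (by simp) (by simp)
      cases t <;> simp [linkB, this]
    | port r' t' =>
      have : ¬ Link T (port r t) (port r' t') := Γ.not_link_of_not_node hT (by simp) (by simp)
      cases t <;> cases t' <;> simp [linkB, this]

omit hT in
/-- The entered rails as a Boolean vector (classically). [folklore] -/
theorem exists_openB : ∃ U : Fin k → Bool, ∀ r, U r = true ↔ IsOpen T Γ.pos r := by
  classical
  exact ⟨fun r => decide (IsOpen T Γ.pos r), fun r => by simp⟩

end family

/-! ### Walks of the explicit link relation and their checks -/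

/-- All vertices, as a list. [folklore] -/
def allV (k K m : ℕ) : List (RailV k K m) :=
  ((List.finRange k).flatMap fun r => (List.finRange K).map fun i => (node (r, i) : RailV k K m)) ++
    ((List.finRange m).map mid ++ (List.finRange k).flatMap fun r => [port r true, port r false])

/-- The list of all vertices is complete. [folklore] -/
theorem mem_allV (v : RailV k K m) : v ∈ allV k K m := by
  cases v with
  | node x =>
    obtain ⟨r, i⟩ := x
    simp only [allV, List.mem_append, List.mem_flatMap, List.mem_finRange, List.mem_map, true_and]
    exact Or.inl ⟨r, i, rfl⟩
  | mid ρ => simp [allV]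
  | port r t => cases t <;> simp [allV]

/-- **Checker for a forced walk** `p₀, ws, p₁` of the explicit link relation: nonempty inner interior,
`p₁` a port, the only link at `p₀` is to the first interior vertex, and every interior vertex is linked
only to its two neighbours on the walk. [folklore] -/
def forcedB (U : Fin k → Bool) (p₀ : RailV k K m) (ws : List (RailV k K m)) (p₁ : RailV k K m) : Bool :=
  let W := p₀ :: (ws ++ [p₁])
  !ws.isEmpty && ws.all isInner && !isInner p₁ &&
    ((allV k K m).all fun y => !Γ.linkB U p₀ y || (ws.head? == some y)) &&
    (List.range (W.length - 2)).all fun i =>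
      (allV k K m).all fun y =>
        !Γ.linkB U (W.getD (i + 1) p₀) y || (y == W.getD i p₀ || y == W.getD (i + 2) p₀)

section sound

variable {P : Finset (RailV k K m)} {T : Set (RailV k K m × List (RailV k K m) × RailV k K m)}
  (hT : StrandFamily Γ.graph Γ.VX P T)
include hT

/-- **Soundness of the forced-walk checker**: a member of the family ending at `p₀` is the checked walk.
[folklore] -/
theorem eq_of_forcedB (U : Fin k → Bool) (hU : ∀ r, U r = true ↔ IsOpen T Γ.pos r) {p₀ p₁ : RailV k K m}
    {ws : List (RailV k K m)} (hW : Γ.forcedB U p₀ ws p₁ = true) {τ : RailV k K m × List (RailV k K m) × RailV k K m}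
    (hτ : τ ∈ T) : (τ.1 = p₀ → τ = (p₀, ws, p₁)) ∧ (τ.2.2 = p₀ → τ = (p₁, ws.reverse, p₀)) := by
  simp only [forcedB, Bool.and_eq_true, Bool.not_eq_true', List.all_eq_true, Bool.or_eq_true, beq_iff_eq,
    List.mem_range] at hW
  obtain ⟨⟨⟨⟨hne, hinner⟩, hp₁⟩, hfirst⟩, hstep⟩ := hW
  have hws : ws ≠ [] := by simpa [List.isEmpty_iff] using hne
  have hwsV : ∀ w ∈ ws, w ∈ Γ.VX := fun w hw => Γ.mem_VX_iff.2 (hinner w hw)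
  have hp₁V : p₁ ∉ Γ.VX := fun h => by simp [Γ.mem_VX_iff.1 h] at hp₁
  refine hT.eq_of_forced hws hwsV hp₁V (fun y hy => ?_) (fun i hi y hy => ?_) hτ
  · rcases hfirst y (mem_allV y) with h | h
    · exact absurd ((Γ.link_iff_linkB hT U hU p₀ y).1 hy) (by simp [h])
    · exact h.symm
  · have hl := (Γ.link_iff_linkB hT U hU _ y).1 hy
    have hlen : (p₀ :: (ws ++ [p₁])).length = ws.length + 2 := by simp
    have hl' : Γ.linkB U ((p₀ :: (ws ++ [p₁])).getD (i + 1) p₀) y = true := by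
      rw [List.getD_eq_getElem _ _ (by omega)]; exact hl
    rcases hstep i (by rw [hlen]; simp at hi; omega) y (mem_allV y) with h | h | h
    · rw [hl'] at h
      exact absurd h (by simp)
    · rw [List.getD_eq_getElem _ _ (by omega)] at h
      exact Or.inl h
    · rw [List.getD_eq_getElem _ _ hi] at h
      exact Or.inr h

end sound

/-! ### Computing the walks -/

/-- The next vertex along the explicit link relation, avoiding the previous one. [folklore] -/
def next? (U : Fin k → Bool) (prev cur : RailV k K m) : Option (RailV k K m) :=
  (allV k K m).find? fun y => Γ.linkB U cur y && !(y == prev)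

/-- Follow the explicit link relation from `cur` (coming from `prev`) until a port is reached (or the
fuel is exhausted). [folklore] -/
def follow (U : Fin k → Bool) : RailV k K m → RailV k K m → ℕ → List (RailV k K m)
  | _, cur, 0 => [cur]
  | prev, cur, n + 1 =>
    if isInner cur then
      match Γ.next? U prev cur with
      | some y => cur :: follow U cur y n
      | none => [cur]
    else [cur]

/-- The walk entering rail `r` at its top port: interior and final vertex. [folklore] -/
def walkT (U : Fin k → Bool) (r : Fin k) : List (RailV k K m) × RailV k K m :=
  let l := Γ.follow U (port r true) (nodeAt r 0 Γ.pos) (k * K + m + 2)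
  (l.dropLast, l.getLastD (port r true))

/-- The walk entering rail `r` at its bottom port: interior and final vertex. [folklore] -/
def walkF (U : Fin k → Bool) (r : Fin k) : List (RailV k K m) × RailV k K m :=
  let l := Γ.follow U (port r false) (nodeAt r (K - 1) (by have := Γ.two_le; omega)) (k * K + m + 2)
  (l.dropLast, l.getLastD (port r false))

/-- **Exclusivity check for the entered set `U`**: the walks from the ports of the entered rails are
forced walks, and either they pair every rail's two ports and cover the gadget ("`U` is realisable"),
or some gadget vertex lies on none of them ("`U` is impossible"). [folklore] -/
def exclCheckB (U : Fin k → Bool) : Bool :=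
  ((List.finRange k).all fun r =>
      !U r || (Γ.forcedB U (port r true) (Γ.walkT U r).1 (Γ.walkT U r).2 &&
        Γ.forcedB U (port r false) (Γ.walkF U r).1 (Γ.walkF U r).2)) &&
    (((List.finRange k).all fun r => !U r || ((Γ.walkT U r).2 == port r false && (Γ.walkF U r).2 == port r true)) ||
      (allV k K m).any fun v =>
        isInner v && (List.finRange k).all fun r => !U r || (!((Γ.walkT U r).1.contains v) && !((Γ.walkF U r).1.contains v)))

/-- All `2^k` entered sets, as Boolean vectors read off the bits of `n < 2^k`. [folklore] -/
def bitsU (k n : ℕ) : Fin k → Bool := fun r => n.testBit r.val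

/-- Every Boolean vector of rails is read off some `n < 2^k`. [folklore] -/
theorem exists_bitsU (U : Fin k → Bool) : ∃ n < 2 ^ k, bitsU k n = U := by
  refine ⟨Nat.ofBits fun r : Fin k => U r, Nat.ofBits_lt_two_pow _, ?_⟩
  funext r
  simp [bitsU]

/-- The slots of the gadget. [folklore] -/
def slots : Finset (RailV k K m × RailV k K m) :=
  Finset.univ.image Γ.slot

/-- Membership in the set of slots. [folklore] -/
theorem mem_slots_iff {e : RailV k K m × RailV k K m} : e ∈ Γ.slots ↔ ∃ r, e = Γ.slot r := by
  simp [slots, eq_comm]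

/-- The ports of the slots are the ports. [folklore] -/
theorem mem_ports_slots_iff {p : RailV k K m} : p ∈ ports Γ.slots ↔ ∃ r t, p = port r t := by
  rw [mem_ports_iff]
  constructor
  · rintro ⟨e, he, hp⟩
    obtain ⟨r, rfl⟩ := Γ.mem_slots_iff.1 he
    rcases hp with rfl | rfl
    · exact ⟨r, true, rfl⟩
    · exact ⟨r, false, rfl⟩
  · rintro ⟨r, t, rfl⟩
    refine ⟨Γ.slot r, Γ.mem_slots_iff.2 ⟨r, rfl⟩, ?_⟩
    cases t
    · exact Or.inr rfl
    · exact Or.inl rfl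

/-- The two ports of a rail form a slot. [folklore] -/
theorem slotOf_slots (r : Fin k) : slotOf Γ.slots (port r true) (port r false) :=
  Or.inl (Γ.mem_slots_iff.2 ⟨r, rfl⟩)

section excl

variable {P : Finset (RailV k K m)} {T : Set (RailV k K m × List (RailV k K m) × RailV k K m)}
  (hT : StrandFamily Γ.graph Γ.VX P T)
include hT

/-- A link at a bottom port enters the rail. [folklore] -/
theorem isOpen_of_link_port_false {r : Fin k} {y : RailV k K m} (h : Link T (port r false) y) :
    IsOpen T Γ.pos r := by
  have hK := Γ.two_le
  obtain ⟨x, rfl, h1, h2⟩ := (Γ.adj_port_false_iff).1 (hT.adj_of_link h)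
  rw [node_eq_nodeAt_of h1 (i := K - 1) (by omega) (by omega), link_comm] at h
  exact (Γ.link_port_false_iff hT r).1 h

/-- The first link of a member: its start port is linked to its first inner vertex. [folklore] -/
theorem link_fst_head {τ : RailV k K m × List (RailV k K m) × RailV k K m} (hτ : τ ∈ T) :
    ∃ y, Link T τ.1 y := by
  obtain ⟨-, -, hne, -, -, -⟩ := hT.strand τ hτ
  obtain ⟨y, rest, hy⟩ := List.exists_cons_of_ne_nil hne
  exact ⟨y, τ, hτ, Or.inl ⟨[], rest ++ [τ.2.2], by simp [piece, hy]⟩⟩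

/-- A member starting at a port of rail `r` enters rail `r`. [folklore] -/
theorem isOpen_of_fst_eq {τ : RailV k K m × List (RailV k K m) × RailV k K m} (hτ : τ ∈ T) {r : Fin k} {t : Bool}
    (h : τ.1 = port r t) : IsOpen T Γ.pos r := by
  obtain ⟨y, hy⟩ := Γ.link_fst_head hT hτ
  rw [h] at hy
  cases t
  · exact Γ.isOpen_of_link_port_false hT hy
  · exact Γ.isOpen_of_link_port_true hT hy

end excl

/-- **Exclusivity of a rail gadget from the finite check.** [folklore] -/
theorem exclusive_of_exclCheckB (h : ∀ n < 2 ^ k, Γ.exclCheckB (bitsU k n) = true) :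
    Exclusive Γ.graph Γ.VX Γ.slots := by
  refine exclusive_of_strandFamily (fun p hp => ?_) fun T hT τ hτ => ?_
  · obtain ⟨r, t, rfl⟩ := Γ.mem_ports_slots_iff.1 hp
    exact Γ.port_not_mem r t
  · obtain ⟨U, hU⟩ := Γ.exists_openB (T := T)
    obtain ⟨n, hn, rfl⟩ := exists_bitsU U
    have hc := h n hn
    simp only [exclCheckB, Bool.and_eq_true, List.all_eq_true, List.mem_finRange, true_implies, Bool.or_eq_true,
      Bool.not_eq_true', beq_iff_eq, List.any_eq_true] at hc
    obtain ⟨hforced, hgood | ⟨v, -, hv, hnone⟩⟩ := hc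
    · -- realisable: every member is a walk pairing the two ports of its rail
      obtain ⟨hp, -, -⟩ := hT.strand τ hτ
      obtain ⟨r, t, hr⟩ := Γ.mem_ports_slots_iff.1 hp
      have ho : bitsU k n r = true := (hU r).2 (Γ.isOpen_of_fst_eq hT hτ hr)
      rcases hforced r with hx | ⟨hwT, hwF⟩
      · simp [hx] at ho
      rcases hgood r with hx | ⟨hpT, hpF⟩
      · simp [hx] at ho
      cases t
      · have := (Γ.eq_of_forcedB hT _ hU hwF hτ).1 hr
        rw [this, hpF]
        exact slotOf_comm.1 (Γ.slotOf_slots r)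
      · have := (Γ.eq_of_forcedB hT _ hU hwT hτ).1 hr
        rw [this, hpT]
        exact Γ.slotOf_slots r
    · -- impossible: the uncovered vertex `v` lies on some member, which is a walk
      exfalso
      obtain ⟨σ, hσ, hvσ⟩ := hT.cover v (Γ.mem_VX_iff.2 hv)
      obtain ⟨hp, -, -⟩ := hT.strand σ hσ
      obtain ⟨r, t, hr⟩ := Γ.mem_ports_slots_iff.1 hp
      have ho : bitsU k n r = true := (hU r).2 (Γ.isOpen_of_fst_eq hT hσ hr)
      rcases hforced r with hx | ⟨hwT, hwF⟩
      · simp [hx] at ho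
      rcases hnone r with hx | ⟨hnT, hnF⟩
      · simp [hx] at ho
      cases t
      · have := (Γ.eq_of_forcedB hT _ hU hwF hσ).1 hr
        rw [this] at hvσ
        have h' : List.elem v (Γ.walkF (bitsU k n) r).1 = true := List.elem_eq_true_of_mem hvσ
        change List.elem v _ = false at hnF
        rw [h'] at hnF
        exact Bool.noConfusion hnF
      · have := (Γ.eq_of_forcedB hT _ hU hwT hσ).1 hr
        rw [this] at hvσ
        have h' : List.elem v (Γ.walkT (bitsU k n) r).1 = true := List.elem_eq_true_of_mem hvσ
        change List.elem v _ = false at hnT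
        rw [h'] at hnT
        exact Bool.noConfusion hnT

/-! ### Census from the finite checks -/

/-- The slot map is injective. [folklore] -/
theorem slot_injective : Function.Injective Γ.slot := by
  intro r r' h
  simp only [slot, Prod.mk.injEq, port.injEq, and_true] at h
  exact h.1

/-- Membership in a set of slots given by rails. [folklore] -/
theorem mem_image_slot_iff {U₀ : Finset (Fin k)} {e : RailV k K m × RailV k K m} :
    e ∈ U₀.image Γ.slot ↔ ∃ r ∈ U₀, Γ.slot r = e :=
  Finset.mem_image

/-- The ports of a set of slots given by rails. [folklore] -/
theorem mem_ports_image_iff {U₀ : Finset (Fin k)} {p : RailV k K m} :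
    p ∈ ports (U₀.image Γ.slot) ↔ ∃ r ∈ U₀, p = port r true ∨ p = port r false := by
  rw [mem_ports_iff]
  constructor
  · rintro ⟨e, he, hp⟩
    obtain ⟨r, hr, rfl⟩ := Γ.mem_image_slot_iff.1 he
    exact ⟨r, hr, hp⟩
  · rintro ⟨r, hr, hp⟩
    exact ⟨Γ.slot r, Γ.mem_image_slot_iff.2 ⟨r, hr, rfl⟩, hp⟩

/-- The indicator vector of a set of rails. [folklore] -/
def indB (U₀ : Finset (Fin k)) : Fin k → Bool := fun r => decide (r ∈ U₀)

/-- **The cover read off the walks**: on the slot of an entered rail the interior of its walk, the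
empty list elsewhere. [folklore] -/
def coverFun (U : Fin k → Bool) (e : RailV k K m × RailV k K m) : List (RailV k K m) :=
  match (List.finRange k).find? fun r => U r && (e == Γ.slot r) with
  | some r => (Γ.walkT U r).1
  | none => []

/-- `coverFun` on the slot of an entered rail. [folklore] -/
theorem coverFun_slot {U : Fin k → Bool} {r : Fin k} (hr : U r = true) : Γ.coverFun U (Γ.slot r) = (Γ.walkT U r).1 := by
  unfold coverFun
  cases h : (List.finRange k).find? (fun r' => U r' && (Γ.slot r == Γ.slot r')) with
  | none =>
    rw [List.find?_eq_none] at h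
    have := h r (List.mem_finRange r)
    simp [hr] at this
  | some r' =>
    have := List.find?_some h
    simp only [Bool.and_eq_true, beq_iff_eq] at this
    rw [Γ.slot_injective this.2]

/-- `coverFun` off the slots of the entered rails. [folklore] -/
theorem coverFun_of_not {U : Fin k → Bool} {e : RailV k K m × RailV k K m} (he : ∀ r, U r = true → e ≠ Γ.slot r) :
    Γ.coverFun U e = [] := by
  unfold coverFun
  cases h : (List.finRange k).find? (fun r' => U r' && (e == Γ.slot r')) with
  | none => rfl
  | some r' =>
    have := List.find?_some h
    simp only [Bool.and_eq_true, beq_iff_eq] at this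
    exact absurd this.2 (he r' this.1)

/-- **Census check, one cover**: the walks from the top ports of the rails of `U` are forced walks
ending at the bottom ports, simple, along gadget edges, pairwise disjoint and covering. [folklore] -/
def coverCheckB (U : Fin k → Bool) : Bool :=
  ((List.finRange k).all fun r => !U r ||
    (Γ.forcedB U (port r true) (Γ.walkT U r).1 (Γ.walkT U r).2 && ((Γ.walkT U r).2 == port r false) &&
      decide ((Γ.walkT U r).1.Nodup) &&
      decide (List.IsChain Γ.graph.Adj (port r true :: ((Γ.walkT U r).1 ++ [port r false]))))) &&
  ((List.finRange k).all fun r => (List.finRange k).all fun r' =>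
    !U r || (!U r' || ((r == r') || (Γ.walkT U r).1.all fun v => !((Γ.walkT U r').1.contains v)))) &&
  ((allV k K m).all fun v => !isInner v || (List.finRange k).any fun r => U r && (Γ.walkT U r).1.contains v)

/-- **Census check, no cover**: the walks from the top ports of the rails of `U` are forced walks and
miss some gadget vertex. [folklore] -/
def emptyCheckB (U : Fin k → Bool) : Bool :=
  ((List.finRange k).all fun r => !U r || Γ.forcedB U (port r true) (Γ.walkT U r).1 (Γ.walkT U r).2) &&
  ((allV k K m).any fun v => isInner v && (List.finRange k).all fun r => !U r || !((Γ.walkT U r).1.contains v))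

section cover

variable {U₀ : Finset (Fin k)} {f : RailV k K m × RailV k K m → List (RailV k K m)}
  (hf : IsCover Γ.graph Γ.VX (U₀.image Γ.slot) f)
include hf

/-- The strands of a cover of a rail gadget form a strand family. [folklore] -/
theorem strandFamily_cover :
    StrandFamily Γ.graph Γ.VX (ports (U₀.image Γ.slot)) (coverFamily (U₀.image Γ.slot) f) := by
  refine strandFamily_coverFamily hf (fun e he => ?_) (fun e he e' he' hne => ?_) (fun p hp => ?_)
  · obtain ⟨r, -, rfl⟩ := Γ.mem_image_slot_iff.1 he
    simp [slot]
  · obtain ⟨r, -, rfl⟩ := Γ.mem_image_slot_iff.1 he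
    obtain ⟨r', -, rfl⟩ := Γ.mem_image_slot_iff.1 he'
    have hrr' : r ≠ r' := fun h => hne (by rw [h])
    simp [slot, hrr']
  · obtain ⟨r, -, rfl | rfl⟩ := Γ.mem_ports_image_iff.1 hp <;> exact Γ.port_not_mem _ _

/-- The entered rails of a cover are the rails of its slots. [folklore] -/
theorem indB_iff_isOpen (r : Fin k) : indB U₀ r = true ↔ IsOpen (coverFamily (U₀.image Γ.slot) f) Γ.pos r := by
  have hF := Γ.strandFamily_cover hf
  simp only [indB, decide_eq_true_eq]
  constructor
  · intro hr
    have hτ : (port r true, f (Γ.slot r), port r false) ∈ coverFamily (U₀.image Γ.slot) f :=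
      ⟨Γ.slot r, Γ.mem_image_slot_iff.2 ⟨r, hr, rfl⟩, rfl⟩
    exact Γ.isOpen_of_fst_eq hF hτ (t := true) rfl
  · intro ho
    obtain ⟨τ, hτ, hend⟩ := hF.exists_end_of_link_port (Γ.port_not_mem r true) ho
    obtain ⟨e, he, rfl⟩ := hτ
    obtain ⟨r', hr', rfl⟩ := Γ.mem_image_slot_iff.1 he
    simp only [slot, port.injEq, and_true, Bool.false_eq_true, and_false, or_false] at hend
    rwa [← hend]

/-- The strand of a cover on a checked rail is the walk. [folklore] -/
theorem apply_slot_eq {r : Fin k} (hr : r ∈ U₀) {ws : List (RailV k K m)} {p : RailV k K m}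
    (hc : Γ.forcedB (indB U₀) (port r true) ws p = true) : f (Γ.slot r) = ws := by
  have hF := Γ.strandFamily_cover hf
  have hτ : (port r true, f (Γ.slot r), port r false) ∈ coverFamily (U₀.image Γ.slot) f :=
    ⟨Γ.slot r, Γ.mem_image_slot_iff.2 ⟨r, hr, rfl⟩, rfl⟩
  have := (Γ.eq_of_forcedB hF (indB U₀) (Γ.indB_iff_isOpen hf) hc hτ).1 rfl
  simp only [Prod.mk.injEq, true_and] at this
  exact this.1

end cover

/-- **Census of a rail gadget, one cover**: if the check passes, the covers realising the slots of
`U₀` are exactly `coverFun`. [folklore] -/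
theorem coverSet_eq_singleton (U₀ : Finset (Fin k)) (h : Γ.coverCheckB (indB U₀) = true) :
    coverSet Γ.graph Γ.VX (U₀.image Γ.slot) = {Γ.coverFun (indB U₀)} := by
  simp only [coverCheckB, Bool.and_eq_true, List.all_eq_true, List.mem_finRange, true_implies, Bool.or_eq_true,
    Bool.not_eq_true', beq_iff_eq, decide_eq_true_eq, List.any_eq_true] at h
  obtain ⟨⟨hwalk, hdisj⟩, hcov⟩ := h
  have hind : ∀ r, indB U₀ r = true ↔ r ∈ U₀ := fun r => by simp [indB]
  ext f
  simp only [coverSet, Set.mem_setOf_eq, Set.mem_singleton_iff]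
  constructor
  · intro hf
    funext e
    by_cases he : ∃ r, indB U₀ r = true ∧ e = Γ.slot r
    · obtain ⟨r, hr, rfl⟩ := he
      rcases hwalk r with hx | ⟨⟨⟨hforced, -⟩, -⟩, -⟩
      · simp [hx] at hr
      rw [Γ.coverFun_slot hr, Γ.apply_slot_eq hf ((hind r).1 hr) hforced]
    · simp only [not_exists, not_and] at he
      rw [Γ.coverFun_of_not (fun r hr => he r hr), hf.2.1 e ?_]
      intro hmem
      obtain ⟨r, hr, rfl⟩ := Γ.mem_image_slot_iff.1 hmem
      exact he r ((hind r).2 hr) rfl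
  · rintro rfl
    refine ⟨fun e he => ?_, fun e he => ?_, fun e he e' he' hne => ?_, fun v hv => ?_⟩
    · obtain ⟨r, hr, rfl⟩ := Γ.mem_image_slot_iff.1 he
      have hr' := (hind r).2 hr
      rcases hwalk r with hx | ⟨⟨⟨hforced, hlast⟩, hnd⟩, hchain⟩
      · simp [hx] at hr'
      rw [Γ.coverFun_slot hr']
      simp only [forcedB, Bool.and_eq_true, Bool.not_eq_true', List.all_eq_true] at hforced
      obtain ⟨⟨⟨⟨hne, hinner⟩, -⟩, -⟩, -⟩ := hforced
      exact ⟨by simpa [List.isEmpty_iff] using hne, fun x hx => Γ.mem_VX_iff.2 (hinner x hx), hnd, hchain⟩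
    · refine Γ.coverFun_of_not fun r hr heq => he ?_
      rw [heq]
      exact Γ.mem_image_slot_iff.2 ⟨r, (hind r).1 hr, rfl⟩
    · obtain ⟨r, hr, rfl⟩ := Γ.mem_image_slot_iff.1 he
      obtain ⟨r', hr', rfl⟩ := Γ.mem_image_slot_iff.1 he'
      have hrr' : r ≠ r' := fun h => hne (by rw [h])
      rw [Γ.coverFun_slot ((hind r).2 hr), Γ.coverFun_slot ((hind r').2 hr')]
      intro v hv hv'
      rcases hdisj r r' with hx | hx | hx | hall
      · simp [(hind r).2 hr] at hx
      · simp [(hind r').2 hr'] at hx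
      · exact hrr' hx
      · have := hall v hv
        have h' : List.elem v (Γ.walkT (indB U₀) r').1 = true := List.elem_eq_true_of_mem hv'
        change List.elem v _ = false at this
        rw [h'] at this
        exact Bool.noConfusion this
    · rcases hcov v (mem_allV v) with hx | ⟨r, -, hr, hmem⟩
      · simp [Γ.mem_VX_iff.1 hv] at hx
      · refine ⟨Γ.slot r, Γ.mem_image_slot_iff.2 ⟨r, (hind r).1 hr, rfl⟩, ?_⟩
        rw [Γ.coverFun_slot hr]
        exact List.mem_of_elem_eq_true hmem

/-- **Census of a rail gadget, no cover**: if the check passes, no cover realises the slots of `U₀`.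
[folklore] -/
theorem coverSet_eq_empty (U₀ : Finset (Fin k)) (h : Γ.emptyCheckB (indB U₀) = true) :
    coverSet Γ.graph Γ.VX (U₀.image Γ.slot) = ∅ := by
  simp only [emptyCheckB, Bool.and_eq_true, List.all_eq_true, List.mem_finRange, true_implies, Bool.or_eq_true,
    Bool.not_eq_true', List.any_eq_true] at h
  obtain ⟨hwalk, v, -, hv, hnone⟩ := h
  have hind : ∀ r, indB U₀ r = true ↔ r ∈ U₀ := fun r => by simp [indB]
  ext f
  simp only [coverSet, Set.mem_setOf_eq, Set.mem_empty_iff_false, iff_false]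
  intro hf
  obtain ⟨e, he, hve⟩ := hf.2.2.2 v (Γ.mem_VX_iff.2 hv)
  obtain ⟨r, hr, rfl⟩ := Γ.mem_image_slot_iff.1 he
  have hr' := (hind r).2 hr
  rcases hwalk r with hx | hforced
  · simp [hx] at hr'
  rw [Γ.apply_slot_eq hf hr hforced] at hve
  rcases hnone r with hx | hx
  · simp [hx] at hr'
  · have h' : List.elem v (Γ.walkT (indB U₀) r).1 = true := List.elem_eq_true_of_mem hve
    change List.elem v _ = false at hx
    rw [h'] at hx
    exact Bool.noConfusion hx

/-- No cover realises no slot (the gadget is not empty). [folklore] -/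
theorem coverSet_empty_slots (hk : 0 < k) : coverSet Γ.graph Γ.VX (∅ : Finset (RailV k K m × RailV k K m)) = ∅ := by
  ext f
  simp only [coverSet, Set.mem_setOf_eq, Set.mem_empty_iff_false, iff_false]
  intro hf
  obtain ⟨e, he, -⟩ := hf.2.2.2 (nodeAt ⟨0, hk⟩ 0 Γ.pos) (Γ.node_mem _)
  simp at he

/-- Every set of slots is the image of a set of rails. [folklore] -/
theorem exists_eq_image_of_subset {U : Finset (RailV k K m × RailV k K m)} (hU : U ⊆ Γ.slots) :
    ∃ U₀ : Finset (Fin k), U = U₀.image Γ.slot := by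
  classical
  obtain ⟨U₀, -, hU₀⟩ := Finset.subset_image_iff.1 (show U ⊆ Finset.univ.image Γ.slot from hU)
  exact ⟨U₀, hU₀.symm⟩

end RailGadget

end Literature.Combinatorics.SimpleGraph
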